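import Mathlib
import Summits.KontsevichZagierPeriods.KontsevichZagierPeriods.Theses.TorsionLogs

/-!
# Route TorsionLogs — support item `GKZLevelThreePair`: the T-chain, step (N1), algebra of the
# cube-root chart `x³ = R(t,y) = (1-t)/(t(1-y²t))`

Helper file for item `stmt-KontsevichZagierPeriods-13812` (`GKZLevelThreePair`), blueprint v3. The
level-3 Euler curve `w³ = t(1-t)²(1-zt)` (`z = y²`) has the hyperelliptic model
`Y² = x⁶ + 2(1-2z)x³ + 1 = (x³+1)² - 4zx³` through `x³ = R(t) := (1-t)/(t(1-zt))`
(`x = (1-t)/w`), with `dx/Y = -dt/(3w)`. This file records the real algebra behind the change of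
variables `(t,y) ↦ (x,y)` of the T-chain (no representations yet):

* `cubeChart_radicand` — `(R+1)² - 4zR = ((zt²-2zt+1)/(t(1-zt)))²`;
* `hasDerivAt_cubeChartR` — `∂R/∂t = -(zt²-2zt+1)/(t²(1-zt)²)`;
* `cubeChart_pullback` — with `x = R^{1/3}`:
  `t^{-1/3}(1-t)^{-2/3}(1-zt)^{-1/3} = 3/√((x³+1)²-4zx³) · ((1/3)·x/R·|∂R/∂t|)` (proved by comparing
  cubes: both sides are positive with cube `1/(t(1-t)²(1-zt))`);
* `cubeChartR_injective` — `t ↦ R(t)` is injective on `(0,1)` (for `0 ≤ z < 1`);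
* `exists_cubeChartR_eq` — `t ↦ R(t)` maps `(0,1)` onto `(0,∞)` (intermediate values).

## References

* M. Kontsevich, D. Zagier, *Periods* (2001), §1.2 rule (2).
-/

-- `Summit.<Summit>.<Sub>` with Sub = Summit (single-conjunct summit, D-0017) duplicates the segment.
set_option linter.dupNamespace false

noncomputable section

namespace Summit.KontsevichZagierPeriods.KontsevichZagierPeriods.Theorems.GKZLevelThree

open Set

/-- `zt² - 2zt + 1 = z(1-t)² + (1-z) > 0` for `z < 1`. -/
theorem cubeChart_num_pos {z t : ℝ} (hz : z < 1) (hz0 : 0 ≤ z) : 0 < z * t ^ 2 - 2 * z * t + 1 := by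
  have h := mul_nonneg hz0 (sq_nonneg (1 - t))
  nlinarith [h]

/-- `R(t) = (1-t)/(t(1-zt)) > 0` on `(0,1)` (`z < 1`). -/
theorem cubeChartR_pos {z t : ℝ} (hz : z < 1) (ht0 : 0 < t) (ht1 : t < 1) :
    0 < (1 - t) / (t * (1 - z * t)) := by
  have h1 : 0 < 1 - z * t := by nlinarith [mul_pos (sub_pos.2 hz) ht0]
  have h2 : 0 < 1 - t := by linarith
  positivity

/-- **The radicand in the chart**: `(R+1)² - 4zR = ((zt²-2zt+1)/(t(1-zt)))²`. -/
theorem cubeChart_radicand {z t : ℝ} (ht0 : t ≠ 0) (hzt : 1 - z * t ≠ 0) :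
    ((1 - t) / (t * (1 - z * t)) + 1) ^ 2 - 4 * z * ((1 - t) / (t * (1 - z * t))) =
      ((z * t ^ 2 - 2 * z * t + 1) / (t * (1 - z * t))) ^ 2 := by
  have hden : t * (1 - z * t) ≠ 0 := mul_ne_zero ht0 hzt
  have hzt2 : 1 - t * z ≠ 0 := by rw [mul_comm t z]; exact hzt
  field_simp
  ring

/-- **`∂R/∂t`**: the `t`-derivative of `R(t) = (1-t)/(t(1-zt))` is `-(zt²-2zt+1)/(t²(1-zt)²)`. -/
theorem hasDerivAt_cubeChartR {z t : ℝ} (ht0 : t ≠ 0) (hzt : 1 - z * t ≠ 0) :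
    HasDerivAt (fun t : ℝ => (1 - t) / (t * (1 - z * t)))
      (-(z * t ^ 2 - 2 * z * t + 1) / (t ^ 2 * (1 - z * t) ^ 2)) t := by
  have h1 : HasDerivAt (fun t : ℝ => 1 - t) (-1) t := by simpa using (hasDerivAt_id' t).const_sub 1
  have h2 : HasDerivAt (fun t : ℝ => t * (1 - z * t)) (1 * (1 - z * t) + t * (-(z * 1))) t :=
    (hasDerivAt_id' t).mul (((hasDerivAt_id' t).const_mul z).const_sub 1)
  have hden : t * (1 - z * t) ≠ 0 := mul_ne_zero ht0 hzt
  refine (h1.div h2 hden).congr_deriv ?_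
  field_simp
  ring

/-- **The pull-back identity of the chart.** For `0 < t < 1`, `0 ≤ z < 1`, `R = (1-t)/(t(1-zt))` and
`x > 0` with `x³ = R`:
`t^{-1/3}(1-t)^{-2/3}(1-zt)^{-1/3} = 3/√((x³+1)² - 4zx³) · ((1/3)(x/R)·((zt²-2zt+1)/(t²(1-zt)²)))`.
Both sides are positive and have the same cube `1/(t(1-t)²(1-zt))`. -/
theorem cubeChart_pullback {z t x : ℝ} (hz : z < 1) (hz0 : 0 ≤ z) (ht0 : 0 < t) (ht1 : t < 1) (hx : 0 < x)
    (hx3 : x ^ 3 = (1 - t) / (t * (1 - z * t))) :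
    t ^ (-(1:ℝ) / 3) * (1 - t) ^ (-(2:ℝ) / 3) * (1 - z * t) ^ (-(1:ℝ) / 3) =
      3 / Real.sqrt ((x ^ 3 + 1) ^ 2 - 4 * z * x ^ 3) *
        (1 / 3 * (x / ((1 - t) / (t * (1 - z * t)))) * ((z * t ^ 2 - 2 * z * t + 1) / (t ^ 2 * (1 - z * t) ^ 2))) := by
  have h1t : 0 < 1 - t := by linarith
  have hzt : 0 < 1 - z * t := by nlinarith
  have hN : 0 < z * t ^ 2 - 2 * z * t + 1 := cubeChart_num_pos hz hz0
  have hR : 0 < (1 - t) / (t * (1 - z * t)) := cubeChartR_pos hz ht0 ht1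
  -- the radicand and its square root
  have hrad : (x ^ 3 + 1) ^ 2 - 4 * z * x ^ 3 = ((z * t ^ 2 - 2 * z * t + 1) / (t * (1 - z * t))) ^ 2 := by
    rw [hx3]
    exact cubeChart_radicand ht0.ne' hzt.ne'
  have hsqrt : Real.sqrt ((x ^ 3 + 1) ^ 2 - 4 * z * x ^ 3) = (z * t ^ 2 - 2 * z * t + 1) / (t * (1 - z * t)) := by
    rw [hrad, Real.sqrt_sq (by positivity)]
  rw [hsqrt]
  -- compare cubes
  apply (Odd.strictMono_pow (by decide : Odd 3)).injective
  simp only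
  have e1 : (t ^ (-(1:ℝ) / 3)) ^ 3 = t⁻¹ := by
    rw [← Real.rpow_natCast, ← Real.rpow_mul ht0.le, show (-(1:ℝ) / 3 * ((3:ℕ) : ℝ)) = -1 by norm_num,
      Real.rpow_neg_one]
  have e2 : ((1 - t) ^ (-(2:ℝ) / 3)) ^ 3 = ((1 - t) ^ 2)⁻¹ := by
    rw [← Real.rpow_natCast, ← Real.rpow_mul h1t.le, show (-(2:ℝ) / 3 * ((3:ℕ) : ℝ)) = -2 by norm_num,
      Real.rpow_neg h1t.le, Real.rpow_two]
  have e3 : ((1 - z * t) ^ (-(1:ℝ) / 3)) ^ 3 = (1 - z * t)⁻¹ := by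
    rw [← Real.rpow_natCast, ← Real.rpow_mul hzt.le, show (-(1:ℝ) / 3 * ((3:ℕ) : ℝ)) = -1 by norm_num,
      Real.rpow_neg_one]
  rw [mul_pow, mul_pow, e1, e2, e3]
  have ht : t ≠ 0 := ht0.ne'
  have h1t' : (1 - t) ≠ 0 := h1t.ne'
  have hzt' : (1 - z * t) ≠ 0 := hzt.ne'
  have hzt'' : (1 - t * z) ≠ 0 := by rw [mul_comm]; exact hzt'
  have hN' : (z * t ^ 2 - 2 * z * t + 1) ≠ 0 := hN.ne'
  have hx' : x ≠ 0 := hx.ne'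
  -- the base of the right-hand cube is `x/(1-t)`
  have hbase : 3 / ((z * t ^ 2 - 2 * z * t + 1) / (t * (1 - z * t))) *
      (1 / 3 * (x / ((1 - t) / (t * (1 - z * t)))) * ((z * t ^ 2 - 2 * z * t + 1) / (t ^ 2 * (1 - z * t) ^ 2))) =
      x / (1 - t) := by
    generalize hNg : z * t ^ 2 - 2 * z * t + 1 = N
    have hNne : N ≠ 0 := by rw [← hNg]; exact hN'
    rw [div_div_eq_mul_div, div_div_eq_mul_div]
    field_simp
  rw [hbase, div_pow, hx3]
  field_simp

/-- **`R` is injective on `(0,1)`** (`0 ≤ z < 1`): `R(s) = R(t)` forces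
`(s-t)(1 - z(s+t-st)) = 0` and `1 - z(s+t-st) > 0`. -/
theorem cubeChartR_injective {z s t : ℝ} (hz : z < 1) (hz0 : 0 ≤ z) (hs0 : 0 < s) (hs1 : s < 1)
    (ht0 : 0 < t) (ht1 : t < 1) (h : (1 - s) / (s * (1 - z * s)) = (1 - t) / (t * (1 - z * t))) : s = t := by
  have hzs : 0 < 1 - z * s := by nlinarith
  have hzt : 0 < 1 - z * t := by nlinarith
  rw [div_eq_div_iff (mul_pos hs0 hzs).ne' (mul_pos ht0 hzt).ne'] at h
  have hfac : (s - t) * (1 - z * (s + t - s * t)) = 0 := by linear_combination (-1 : ℝ) * h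
  have hpos : 0 < 1 - z * (s + t - s * t) := by
    have : s + t - s * t < 1 := by nlinarith
    nlinarith
  rcases mul_eq_zero.1 hfac with h1 | h1
  · linarith
  · linarith

/-- **`R` maps `(0,1)` onto `(0,∞)`**: for every `c > 0` (`0 ≤ z < 1`) there is `t ∈ (0,1)` with
`R(t) = c` (`R` is continuous on `(0,1)`, large near `0`, small near `1`). -/
theorem exists_cubeChartR_eq {z c : ℝ} (hz : z < 1) (hz0 : 0 ≤ z) (hc : 0 < c) :
    ∃ t : ℝ, 0 < t ∧ t < 1 ∧ (1 - t) / (t * (1 - z * t)) = c := by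
  set R : ℝ → ℝ := fun t => (1 - t) / (t * (1 - z * t)) with hR
  -- a point near 0 where `R > c` and a point near 1 where `R < c`
  set t₁ : ℝ := min (1 / 2) (1 / (2 * (c + 1))) with ht₁
  set δ : ℝ := min (1 / 2) (c * (1 - z) / 4) with hδ
  set t₂ : ℝ := 1 - δ with ht₂
  have hc1 : 0 < 2 * (c + 1) := by positivity
  have ht₁0 : 0 < t₁ := lt_min (by norm_num) (by positivity)
  have ht₁h : t₁ ≤ 1 / 2 := min_le_left _ _
  have ht₁c : t₁ ≤ 1 / (2 * (c + 1)) := min_le_right _ _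
  have hδ0 : 0 < δ := lt_min (by norm_num) (by nlinarith)
  have hδh : δ ≤ 1 / 2 := min_le_left _ _
  have hδc : δ ≤ c * (1 - z) / 4 := min_le_right _ _
  have ht₂1 : t₂ < 1 := by simp [ht₂]; exact hδ0
  have ht₂0 : 1 / 2 ≤ t₂ := by rw [ht₂]; linarith
  have h12 : t₁ ≤ t₂ := by linarith
  have hcont : ContinuousOn R (Icc t₁ t₂) := by
    refine ContinuousOn.div (by fun_prop) (by fun_prop) fun t ht => ?_
    have h0 : 0 < t := ht₁0.trans_le ht.1
    have h1 : t < 1 := ht.2.trans_lt ht₂1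
    have : 0 < 1 - z * t := by nlinarith
    positivity
  -- `R t₁ > c`
  have hR1 : c < R t₁ := by
    simp only [hR]
    have hzt : 0 < 1 - z * t₁ := by nlinarith
    have hzt1 : 1 - z * t₁ ≤ 1 := by nlinarith
    rw [lt_div_iff₀ (by positivity)]
    have h1 : c * (t₁ * (1 - z * t₁)) ≤ c * t₁ :=
      mul_le_mul_of_nonneg_left (by nlinarith) hc.le
    have h2 : c * t₁ ≤ c * (1 / (2 * (c + 1))) := by nlinarith
    have h3 : c * (1 / (2 * (c + 1))) < 1 / 2 := by
      rw [mul_one_div, div_lt_div_iff₀ hc1 (by norm_num : (0:ℝ) < 2)]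
      nlinarith
    linarith
  -- `R t₂ < c`
  have hR2 : R t₂ < c := by
    simp only [hR]
    have hzt : 0 < 1 - z * t₂ := by nlinarith
    have hzt' : 1 - z ≤ 1 - z * t₂ := by nlinarith
    rw [div_lt_iff₀ (by positivity)]
    have h1z : 0 < 1 - z := by linarith
    calc 1 - t₂ = δ := by rw [ht₂]; ring
      _ ≤ c * (1 - z) / 4 := hδc
      _ < c * (t₂ * (1 - z * t₂)) := by
          have : (1 - z) / 4 < t₂ * (1 - z * t₂) := by nlinarith
          nlinarith
  obtain ⟨t, ht, hRt⟩ : c ∈ R '' Icc t₁ t₂ :=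
    intermediate_value_Icc' h12 hcont ⟨hR2.le, hR1.le⟩
  exact ⟨t, ht₁0.trans_le ht.1, ht.2.trans_lt ht₂1, hRt⟩

end Summit.KontsevichZagierPeriods.KontsevichZagierPeriods.Theorems.GKZLevelThree

end
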